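import Literature.Probability.Percolation.SelfRefinementMeasure
import Literature.Probability.Percolation.KohlerSchindlerTassionRSW
import Summits.CriticalPhenomena.CardyFormulaZ2.Theorems.CardySelfRefinementCriticalPathRSWStubCone3LocalC

/-!
# Stub `stub_cone3` of line `finite-size-envelope` (crux `CriticalPathRSW`), part 8:
local combinatorics of a tuple, IV — the atoms at `w` and in the middle

Support file for item `stmt-CriticalPhenomena-10267` (stub `stub_cone3`).  Same setting and local
notations as parts I–II.  An **atom** of the (closed) tuple `(b, d)` in the configuration `V` is a
single sub-edge whose opening alone joins the sides of the box.  By the "adding one open edge"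
lemma its two ends are then joined to opposite sides, and a walk of at most four INTERIOR
(non-axial) labels next to the tuple runs from a vertex joined to one side to a vertex joined to the
other; the surgery lemma makes one of its labels pivotal after opening the previous ones.  The three
atoms give `Cone3.atom_u` (sub-edge at `u`), `Cone3.atom_w` (at `w`) and `Cone3.atom_m` (middle
sub-edge); the walks are parametrised by the row `s = 2t + 1 ∈ {1, -1}` next to the tuple.

References: Aizenman–Grimmett 1991 §3 (local modification arguments); Grimmett 1999 §2.4.
-/

noncomputable section

namespace Summit.CriticalPhenomena.CardyFormulaZ2.Cruxes.CriticalPathRSW.FiniteSizeEnvelope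

open Set
open Literature.Probability.LatticeModels Literature.Probability.Percolation

namespace Cone3

variable {M N : ℕ} {b : Site 2} {d d' : Fin 2}

set_option quotPrecheck false

/-- The local frame of the tuple `(b, d)`: `pt⟪α, β⟫ = 3b + α e_d + β e_{d'}`. -/
local notation "pt⟪" α ", " β "⟫" =>
  ((3 : ℤ) • b + (α : ℤ) • (Pi.single d (1 : ℤ) : Site 2) + (β : ℤ) • (Pi.single d' (1 : ℤ) : Site 2))

/-- Neighbours of `a` through an open label of `U`, inside `B`. -/
local notation "nbr⟪" B ", " U ", " a "⟫" =>
  {b : Site 2 | a ∈ B ∧ b ∈ B ∧ ∃ d : Fin 2,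
    (b = a + Pi.single d 1 ∧ (a, d) ∈ U) ∨ (a = b + Pi.single d 1 ∧ (b, d) ∈ U)}

/-- The open cluster of `a` inside `B`. -/
local notation "clus⟪" B ", " U ", " a "⟫" =>
  {b : Site 2 | Relation.ReflTransGen (fun x y : Site 2 => y ∈ nbr⟪B, U, x⟫) a b}

/-- The vertices joined inside `B` to the side `L`. -/
local notation "side⟪" B ", " U ", " L "⟫" => {v : Site 2 | ∃ a ∈ L, v ∈ clus⟪B, U, a⟫}

/-- The label configurations joining `L` to `R` inside `B`. -/
local notation "joined⟪" B ", " L ", " R "⟫" =>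
  {U : Set (Site 2 × Fin 2) | ∃ a ∈ L, ∃ b ∈ R, b ∈ clus⟪B, U, a⟫}

/-- The box. -/
local notation "Bx" => (KST2023.box M N)

/-- Its left side. -/
local notation "Lx" => {x : Site 2 | x ∈ KST2023.box M N ∧ x 0 = -(M : ℤ)}

/-- Its right side. -/
local notation "Rx" => {x : Site 2 | x ∈ KST2023.box M N ∧ x 0 = (M : ℤ)}

/-- Crossing of the box by a label configuration. -/
local notation "Cr⟪" V "⟫" => (edgeConfig V ∈ KST2023.crossing M N)

/-! ### The atom at `w` -/

/-- **Atom at `w`, generic sides.** -/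
theorem atom_w_aux (hd : d' ≠ d) {V : Set (Site 2 × Fin 2)} {L' R' : Set (Site 2)}
    (P : Set (Site 2 × Fin 2) → Prop) (hP : ∀ U, P U ↔ U ∈ joined⟪Bx, L', R'⟫)
    (hT2 : (pt⟪2, 0⟫, d) ∉ V) (hbox : ∀ j : ℤ, 0 ≤ j → j ≤ 3 → pt⟪j, 0⟫ ∈ Bx)
    (hrow : pt⟪0, 1⟫ ∈ Bx ∨ pt⟪0, -1⟫ ∈ Bx)
    (hwL' : pt⟪3, 0⟫ ∈ L' → ∀ s : ℤ, (s = 1 ∨ s = -1) → pt⟪3, s⟫ ∈ Bx → pt⟪3, s⟫ ∈ L')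
    (hno : V ∉ joined⟪Bx, L', R'⟫) (hw : pt⟪3, 0⟫ ∈ side⟪Bx, V, L'⟫) (hm : pt⟪2, 0⟫ ∈ side⟪Bx, V, R'⟫) :
    ∃ t s : ℤ, (t = 0 ∨ t = -1) ∧ s = 2 * t + 1 ∧
      ((¬ P V ∧ P (V ∪ {(pt⟪2, s⟫, d)})) ∨
        (¬ P (V ∪ {(pt⟪2, s⟫, d)}) ∧ P (V ∪ {(pt⟪2, s⟫, d)} ∪ {(pt⟪2, t⟫, d')})) ∨
        (¬ P V ∧ P (V ∪ {(pt⟪4, t⟫, d')})) ∨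
        (¬ P (V ∪ {(pt⟪4, t⟫, d')}) ∧ P (V ∪ {(pt⟪4, t⟫, d')} ∪ {(pt⟪3, s⟫, d)})) ∨
        (¬ P (V ∪ {(pt⟪4, t⟫, d')} ∪ {(pt⟪3, s⟫, d)}) ∧
          P (V ∪ {(pt⟪4, t⟫, d')} ∪ {(pt⟪3, s⟫, d)} ∪ {(pt⟪2, s⟫, d)})) ∨
        (¬ P (V ∪ {(pt⟪4, t⟫, d')} ∪ {(pt⟪3, s⟫, d)} ∪ {(pt⟪2, s⟫, d)}) ∧
          P (V ∪ {(pt⟪4, t⟫, d')} ∪ {(pt⟪3, s⟫, d)} ∪ {(pt⟪2, s⟫, d)} ∪ {(pt⟪2, t⟫, d')}))) := by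
  have hm2B := hbox 2 (by norm_num) (by norm_num)
  have hwB := hbox 3 (by norm_num) le_rfl
  simp only [hP]
  -- the two-label walk from a port `pt⟪3, s⟫`
  have two : ∀ {t s : ℤ}, (t = 0 ∨ t = -1) → s = 2 * t + 1 → pt⟪3, s⟫ ∈ side⟪Bx, V, L'⟫ → pt⟪3, s⟫ ∈ Bx →
      ∃ t s : ℤ, (t = 0 ∨ t = -1) ∧ s = 2 * t + 1 ∧
      ((V ∉ joined⟪Bx, L', R'⟫ ∧ V ∪ {(pt⟪2, s⟫, d)} ∈ joined⟪Bx, L', R'⟫) ∨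
        (V ∪ {(pt⟪2, s⟫, d)} ∉ joined⟪Bx, L', R'⟫ ∧
          V ∪ {(pt⟪2, s⟫, d)} ∪ {(pt⟪2, t⟫, d')} ∈ joined⟪Bx, L', R'⟫) ∨
        (V ∉ joined⟪Bx, L', R'⟫ ∧ V ∪ {(pt⟪4, t⟫, d')} ∈ joined⟪Bx, L', R'⟫) ∨
        (V ∪ {(pt⟪4, t⟫, d')} ∉ joined⟪Bx, L', R'⟫ ∧
          V ∪ {(pt⟪4, t⟫, d')} ∪ {(pt⟪3, s⟫, d)} ∈ joined⟪Bx, L', R'⟫) ∨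
        (V ∪ {(pt⟪4, t⟫, d')} ∪ {(pt⟪3, s⟫, d)} ∉ joined⟪Bx, L', R'⟫ ∧
          V ∪ {(pt⟪4, t⟫, d')} ∪ {(pt⟪3, s⟫, d)} ∪ {(pt⟪2, s⟫, d)} ∈ joined⟪Bx, L', R'⟫) ∨
        (V ∪ {(pt⟪4, t⟫, d')} ∪ {(pt⟪3, s⟫, d)} ∪ {(pt⟪2, s⟫, d)} ∉ joined⟪Bx, L', R'⟫ ∧
          V ∪ {(pt⟪4, t⟫, d')} ∪ {(pt⟪3, s⟫, d)} ∪ {(pt⟪2, s⟫, d)} ∪ {(pt⟪2, t⟫, d')} ∈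
            joined⟪Bx, L', R'⟫)) := by
    intro t s ht hs hp hpB
    refine ⟨t, s, ht, hs, ?_⟩
    rcases walk_w2 hd ht hs hno hp hpB hm hm2B with h | h
    · exact Or.inl h
    · exact Or.inr (Or.inl h)
  rcases side_cases hw with hwL | ⟨p, hp, hpw⟩
  · obtain ⟨t, s, ht, hs, hsB⟩ := exists_row hrow
    have h3s : pt⟪3, s⟫ ∈ Bx := pt_mem_box_mix hd hwB hsB
    exact two ht hs (mem_side_of_mem (hwL' hwL s (by omega) h3s)) h3s
  · have hpw' := nbr_symm hpw
    have hpB : p ∈ Bx := hpw'.2.1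
    rcases nbr_pt hd hpw' with ⟨-, rfl⟩ | ⟨h, -⟩ | ⟨-, rfl⟩ | ⟨-, rfl⟩
    · -- port `pt⟪4, 0⟫`: the four-label walk
      simp only [show (3 : ℤ) + 1 = 4 by norm_num] at hp hpB
      obtain ⟨t, s, ht, hs, hsB⟩ := exists_row hrow
      refine ⟨t, s, ht, hs, ?_⟩
      rcases walk_w4 hd ht hs hno hp hpB hsB hm hm2B hwB with h | h | h | h
      · exact Or.inr (Or.inr (Or.inl h))
      · exact Or.inr (Or.inr (Or.inr (Or.inl h)))
      · exact Or.inr (Or.inr (Or.inr (Or.inr (Or.inl h))))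
      · exact Or.inr (Or.inr (Or.inr (Or.inr (Or.inr h))))
    · simp only [show (3 : ℤ) - 1 = 2 by norm_num] at h
      exact absurd h hT2
    · simp only [show (0 : ℤ) + 1 = 1 by norm_num] at hp hpB
      exact two (t := 0) (Or.inl rfl) (by norm_num) hp hpB
    · simp only [show (0 : ℤ) - 1 = -1 by norm_num] at hp hpB
      exact two (t := -1) (Or.inr rfl) (by norm_num) hp hpB

/-- **Atom at `w`.** If the tuple is closed in `V`, the sides of the box are not joined by `V` but
are joined by `V ∪ {last sub-edge}`, then along one of the two walks next to `w` some interior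
label becomes pivotal after opening the previous labels of the walk. -/
theorem atom_w (hd : d' ≠ d) {V : Set (Site 2 × Fin 2)} (hT2 : (pt⟪2, 0⟫, d) ∉ V)
    (hbox : ∀ j : ℤ, 0 ≤ j → j ≤ 3 → pt⟪j, 0⟫ ∈ Bx) (hrow : pt⟪0, 1⟫ ∈ Bx ∨ pt⟪0, -1⟫ ∈ Bx)
    (hwL : pt⟪3, 0⟫ ∉ Lx)
    (hwR : pt⟪3, 0⟫ ∈ Rx → ∀ s : ℤ, (s = 1 ∨ s = -1) → pt⟪3, s⟫ ∈ Bx → pt⟪3, s⟫ ∈ Rx)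
    (hno : ¬ Cr⟪V⟫) (hyes : Cr⟪V ∪ {(pt⟪2, 0⟫, d)}⟫) :
    ∃ t s : ℤ, (t = 0 ∨ t = -1) ∧ s = 2 * t + 1 ∧
      ((¬ Cr⟪V⟫ ∧ Cr⟪V ∪ {(pt⟪2, s⟫, d)}⟫) ∨
        (¬ Cr⟪V ∪ {(pt⟪2, s⟫, d)}⟫ ∧ Cr⟪V ∪ {(pt⟪2, s⟫, d)} ∪ {(pt⟪2, t⟫, d')}⟫) ∨
        (¬ Cr⟪V⟫ ∧ Cr⟪V ∪ {(pt⟪4, t⟫, d')}⟫) ∨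
        (¬ Cr⟪V ∪ {(pt⟪4, t⟫, d')}⟫ ∧ Cr⟪V ∪ {(pt⟪4, t⟫, d')} ∪ {(pt⟪3, s⟫, d)}⟫) ∨
        (¬ Cr⟪V ∪ {(pt⟪4, t⟫, d')} ∪ {(pt⟪3, s⟫, d)}⟫ ∧
          Cr⟪V ∪ {(pt⟪4, t⟫, d')} ∪ {(pt⟪3, s⟫, d)} ∪ {(pt⟪2, s⟫, d)}⟫) ∨
        (¬ Cr⟪V ∪ {(pt⟪4, t⟫, d')} ∪ {(pt⟪3, s⟫, d)} ∪ {(pt⟪2, s⟫, d)}⟫ ∧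
          Cr⟪V ∪ {(pt⟪4, t⟫, d')} ∪ {(pt⟪3, s⟫, d)} ∪ {(pt⟪2, s⟫, d)} ∪ {(pt⟪2, t⟫, d')}⟫)) := by
  have hP : ∀ U : Set (Site 2 × Fin 2), Cr⟪U⟫ ↔ U ∈ joined⟪Bx, Lx, Rx⟫ :=
    fun U => edgeConfig_mem_crossing_iff U M N
  have hP' : ∀ U : Set (Site 2 × Fin 2), Cr⟪U⟫ ↔ U ∈ joined⟪Bx, Rx, Lx⟫ :=
    fun U => (hP U).trans ⟨joined_symm, joined_symm⟩
  have hadj : pt⟪3, 0⟫ ∈ nbr⟪Bx, ({(pt⟪2, 0⟫, d)} : Set (Site 2 × Fin 2)), pt⟪2, 0⟫⟫ :=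
    adj_d hd (by norm_num) (hbox 2 (by norm_num) (by norm_num)) (hbox 3 (by norm_num) le_rfl) (Set.mem_singleton _)
  rcases add_edge hadj ((hP V).not.1 hno) ((hP _).1 hyes) with ⟨hmL, hwR'⟩ | ⟨hwL', hmR⟩
  · exact atom_w_aux hd (fun U => Cr⟪U⟫) hP' hT2 hbox hrow hwR ((hP' V).not.1 hno) hwR' hmL
  · exact atom_w_aux hd (fun U => Cr⟪U⟫) hP hT2 hbox hrow (fun h => absurd h hwL)
      ((hP V).not.1 hno) hwL' hmR

/-! ### The middle atom -/

/-- **Middle atom, generic sides.** -/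
theorem atom_m_aux (hd : d' ≠ d) {V : Set (Site 2 × Fin 2)} {L' R' : Set (Site 2)}
    (P : Set (Site 2 × Fin 2) → Prop) (hP : ∀ U, P U ↔ U ∈ joined⟪Bx, L', R'⟫)
    (hbox : ∀ j : ℤ, 0 ≤ j → j ≤ 3 → pt⟪j, 0⟫ ∈ Bx) (hrow : pt⟪0, 1⟫ ∈ Bx ∨ pt⟪0, -1⟫ ∈ Bx)
    (hno : V ∉ joined⟪Bx, L', R'⟫) (hm1 : pt⟪1, 0⟫ ∈ side⟪Bx, V, L'⟫) (hm2 : pt⟪2, 0⟫ ∈ side⟪Bx, V, R'⟫) :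
    ∃ t s : ℤ, (t = 0 ∨ t = -1) ∧ s = 2 * t + 1 ∧
      ((¬ P V ∧ P (V ∪ {(pt⟪1, t⟫, d')})) ∨
        (¬ P (V ∪ {(pt⟪1, t⟫, d')}) ∧ P (V ∪ {(pt⟪1, t⟫, d')} ∪ {(pt⟪1, s⟫, d)})) ∨
        (¬ P (V ∪ {(pt⟪1, t⟫, d')} ∪ {(pt⟪1, s⟫, d)}) ∧
          P (V ∪ {(pt⟪1, t⟫, d')} ∪ {(pt⟪1, s⟫, d)} ∪ {(pt⟪2, t⟫, d')}))) := by
  simp only [hP]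
  obtain ⟨t, s, ht, hs, hsB⟩ := exists_row hrow
  exact ⟨t, s, ht, hs, walk_m3 hd ht hs hno hm1 (hbox 1 (by norm_num) (by norm_num)) hsB hm2
    (hbox 2 (by norm_num) (by norm_num))⟩

/-- **Middle atom.** If the tuple is closed in `V`, the sides of the box are not joined by `V` but
are joined by `V ∪ {middle sub-edge}`, then along the three-label walk next to the tuple some
interior label becomes pivotal after opening the previous labels of the walk. -/
theorem atom_m (hd : d' ≠ d) {V : Set (Site 2 × Fin 2)}
    (hbox : ∀ j : ℤ, 0 ≤ j → j ≤ 3 → pt⟪j, 0⟫ ∈ Bx) (hrow : pt⟪0, 1⟫ ∈ Bx ∨ pt⟪0, -1⟫ ∈ Bx)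
    (hno : ¬ Cr⟪V⟫) (hyes : Cr⟪V ∪ {(pt⟪1, 0⟫, d)}⟫) :
    ∃ t s : ℤ, (t = 0 ∨ t = -1) ∧ s = 2 * t + 1 ∧
      ((¬ Cr⟪V⟫ ∧ Cr⟪V ∪ {(pt⟪1, t⟫, d')}⟫) ∨
        (¬ Cr⟪V ∪ {(pt⟪1, t⟫, d')}⟫ ∧ Cr⟪V ∪ {(pt⟪1, t⟫, d')} ∪ {(pt⟪1, s⟫, d)}⟫) ∨
        (¬ Cr⟪V ∪ {(pt⟪1, t⟫, d')} ∪ {(pt⟪1, s⟫, d)}⟫ ∧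
          Cr⟪V ∪ {(pt⟪1, t⟫, d')} ∪ {(pt⟪1, s⟫, d)} ∪ {(pt⟪2, t⟫, d')}⟫)) := by
  have hP : ∀ U : Set (Site 2 × Fin 2), Cr⟪U⟫ ↔ U ∈ joined⟪Bx, Lx, Rx⟫ :=
    fun U => edgeConfig_mem_crossing_iff U M N
  have hP' : ∀ U : Set (Site 2 × Fin 2), Cr⟪U⟫ ↔ U ∈ joined⟪Bx, Rx, Lx⟫ :=
    fun U => (hP U).trans ⟨joined_symm, joined_symm⟩
  have hadj : pt⟪2, 0⟫ ∈ nbr⟪Bx, ({(pt⟪1, 0⟫, d)} : Set (Site 2 × Fin 2)), pt⟪1, 0⟫⟫ :=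
    adj_d hd (by norm_num) (hbox 1 (by norm_num) (by norm_num)) (hbox 2 (by norm_num) (by norm_num))
      (Set.mem_singleton _)
  rcases add_edge hadj ((hP V).not.1 hno) ((hP _).1 hyes) with ⟨h1L, h2R⟩ | ⟨h2L, h1R⟩
  · exact atom_m_aux hd (fun U => Cr⟪U⟫) hP hbox hrow ((hP V).not.1 hno) h1L h2R
  · exact atom_m_aux hd (fun U => Cr⟪U⟫) hP' hbox hrow ((hP' V).not.1 hno) h1R h2L

end Cone3

/-- **Registered sub-goal `stub_cone3_localD` of stub `stub_cone3`** (`Cone3.atom_m` with all local notations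
expanded). -/
theorem stub_cone3_localD : ∀ {M N : ℕ} {b : Site 2} {d d' : Fin 2} (hd : d' ≠ d) {V : Set (Site 2 × Fin 2)} (hbox : ∀ j : ℤ, 0 ≤ j → j ≤ 3 → (((3 : ℤ) • b + ((j) : ℤ) • (Pi.single d (1 : ℤ) : Site 2) + ((0) : ℤ) • (Pi.single d' (1 : ℤ) : Site 2))) ∈ ((KST2023.box M N))) (hrow : (((3 : ℤ) • b + ((0) : ℤ) • (Pi.single d (1 : ℤ) : Site 2) + ((1) : ℤ) • (Pi.single d' (1 : ℤ) : Site 2))) ∈ ((KST2023.box M N)) ∨ (((3 : ℤ) • b + ((0) : ℤ) • (Pi.single d (1 : ℤ) : Site 2) + ((-1) : ℤ) • (Pi.single d' (1 : ℤ) : Site 2))) ∈ ((KST2023.box M N))) (hno : ¬ ((edgeConfig (V) ∈ KST2023.crossing M N))) (hyes : ((edgeConfig (V ∪ {((((3 : ℤ) • b + ((1) : ℤ) • (Pi.single d (1 : ℤ) : Site 2) + ((0) : ℤ) • (Pi.single d' (1 : ℤ) : Site 2))), d)}) ∈ KST2023.crossing M N))), ∃ t s : ℤ, (t = 0 ∨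 t = -1) ∧ s = 2 * t + 1 ∧ ((¬ ((edgeConfig (V) ∈ KST2023.crossing M N)) ∧ ((edgeConfig (V ∪ {((((3 : ℤ) • b + ((1) : ℤ) • (Pi.single d (1 : ℤ) : Site 2) + ((t) : ℤ) • (Pi.single d' (1 : ℤ) : Site 2))), d')}) ∈ KST2023.crossing M N))) ∨ (¬ ((edgeConfig (V ∪ {((((3 : ℤ) • b + ((1) : ℤ) • (Pi.single d (1 : ℤ) : Site 2) + ((t) : ℤ) • (Pi.single d' (1 : ℤ) : Site 2))), d')}) ∈ KST2023.crossing M N)) ∧ ((edgeConfig (V ∪ {((((3 : ℤ) • b + ((1) : ℤ) • (Pi.single d (1 : ℤ) : Site 2) + ((t) : ℤ) • (Pi.single d' (1 : ℤ) : Site 2))), d')} ∪ {((((3 : ℤ) • b + ((1) : ℤ) • (Pi.single d (1 : ℤ) : Site 2) + ((s) : ℤ) • (Pi.single d' (1 : ℤ) : Site 2))), d)}) ∈ KST2023.crossing M N))) ∨ (¬ ((edgeConfig (V ∪ {((((3 : ℤ) • b + ((1) : ℤ) • (Pi.single d (1 : ℤ) : Site 2) + ((t) : ℤ) • (Pi.single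 d' (1 : ℤ) : Site 2))), d')} ∪ {((((3 : ℤ) • b + ((1) : ℤ) • (Pi.single d (1 : ℤ) : Site 2) + ((s) : ℤ) • (Pi.single d' (1 : ℤ) : Site 2))), d)}) ∈ KST2023.crossing M N)) ∧ ((edgeConfig (V ∪ {((((3 : ℤ) • b + ((1) : ℤ) • (Pi.single d (1 : ℤ) : Site 2) + ((t) : ℤ) • (Pi.single d' (1 : ℤ) : Site 2))), d')} ∪ {((((3 : ℤ) • b + ((1) : ℤ) • (Pi.single d (1 : ℤ) : Site 2) + ((s) : ℤ) • (Pi.single d' (1 : ℤ) : Site 2))), d)} ∪ {((((3 : ℤ) • b + ((2) : ℤ) • (Pi.single d (1 : ℤ) : Site 2) + ((t) : ℤ) • (Pi.single d' (1 : ℤ) : Site 2))), d')}) ∈ KST2023.crossing M N)))) := by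
  intro M N b d d' hd V hbox hrow hno hyes
  exact Cone3.atom_m hd hbox hrow hno hyes

end Summit.CriticalPhenomena.CardyFormulaZ2.Cruxes.CriticalPathRSW.FiniteSizeEnvelope

end
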